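import Literature.Claims.NS.Piromthan2025
import Literature.Analysis.FluidPDE.NSLerayExistenceR3Holds
import HarnessLib

/-!
# C164 `Piromthan2025` — companion kit, part II (rev-2 faces; refuter of record ns-claims-refuter-3 g5)

KILL-TYPE SUPPORT to the VERDICT of record (head = `Step4_CZ`, binder 1, by
`…Theorems.Piromthan2025.not_Step4_CZ`, part I); nothing here moves the head. Targets are faces of the
rev-2 skeleton `Literature.Claims.NS.Piromthan2025` (p538919):

* `not_Step67_abs (P : Posits) : ¬ Step67_abs P` — the (6) ⇒ (7) passage p.3 l.37–48 «Dropping the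
  subdominant dissipation yields a Riccati-type inequality dW/dt ≥ AW² − BW» at the REAL-FUNCTION grain
  (binder 5 of `claim_of_steps_abs`) is false for EVERY posit package `P`: an UPPER bound (6) on `W′`
  cannot yield a LOWER bound (7). Witness: the constant function `w ≡ w₀` with
  `w₀ = max(W₀, B/A + 1)`, `δ(t) = d₀e^{−t}`, `C₁ = C₂ = ν = α = 1`: it satisfies the decay hypothesis,
  (6) (`0 ≤ C₁w₀² + C₂ν w₀/δ²`) and both thresholds, while (7) demands `A w₀² − B w₀ ≤ 0`, false for
  `w₀ > B/A`.
* `not_Step52_S2 : ¬ Step52_S2` — §5.2 (S2) p.6 l.81–83 «∥ω(s)∥L∞ ≳ 1/(T∗ − s)» at the real-function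
  grain (a constant `c = c(A,B)` for every Riccati super-solution unbounded at `T`) is false: the
  super-solutions `w_ε(s) = 2ε/(ε − s)` of `w′ ≥ w² − w` (`A = B = 1`, `ε ≤ 1/2`) blow up at `T = ε`
  with `w_ε(0) = 2`, so `c/T ≤ w(0)` forces `c ≤ 2ε → 0`.
* `not_NoGlobalLerayHopf` — the abstract's weak-continuation face p.1 l.10–11 / §5.2 p.6 l.92–94 read as
  «no global Leray–Hopf weak solution issues from u₀» is false for EVERY datum of the printed class
  (`C_c^∞`, divergence free): the tree's PROVED Leray existence theorem `leray_existence_R3_holds`.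
  (The literal clause of `ClaimedTheorem`, `NoLerayHopfExtension`, asks agreement with the blow-up
  solution and is not addressed here.)

WHAT THIS IS NOT: not a claim about NS regularity or blow-up; not a claim about any author beyond the
typed locator.
-/

set_option linter.dupNamespace false

noncomputable section

open Set MeasureTheory

namespace Summit.NavierStokesRegularity.NavierStokesRegularity.Theorems.Piromthan2025

open Literature.Analysis Literature.Analysis.FluidPDE
open Literature.Claims.NS
open Literature.Claims.NS.Piromthan2025 (E3 Posits Step67_abs Step52_S2 NoGlobalLerayHopf)

/-- **`¬ Step67_abs P` for every posit package** — the (6) ⇒ (7) «dropping the subdominant dissipation»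
passage p.3 l.37–48 at the real-function grain: the constant function `w ≡ max(W₀, B/A + 1)` with
`δ(t) = d₀e^{−t}` obeys the decay hypothesis, the upper bound (6) and the thresholds, and violates the
lower bound (7) at `t = 0`. [cite: Piromthan2025, p.3 l.37–48] -/
theorem not_Step67_abs (P : Posits) : ¬ Step67_abs P := by
  intro h
  obtain ⟨hA, hB, habs⟩ := h 1 1 1 1 one_pos one_pos one_pos one_pos
  have hBA : 0 < P.B 1 1 / P.A 1 1 := div_pos hB hA
  have hw₀ : P.B 1 1 / P.A 1 1 + 1 ≤ max (P.W₀ 1 1) (P.B 1 1 / P.A 1 1 + 1) := le_max_right _ _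
  have hw₀pos : 0 < max (P.W₀ 1 1) (P.B 1 1 / P.A 1 1 + 1) := by linarith
  have key : P.A 1 1 * max (P.W₀ 1 1) (P.B 1 1 / P.A 1 1 + 1) ^ 2 -
      P.B 1 1 * max (P.W₀ 1 1) (P.B 1 1 / P.A 1 1 + 1) ≤ 0 :=
    habs 1 (fun _ => max (P.W₀ 1 1) (P.B 1 1 / P.A 1 1 + 1))
      (fun t => P.d₀ 1 1 * Real.exp (-(1 * t))) (fun _ => 0)
      (fun t _ => by simp)
      (fun t _ => ⟨hasDerivWithinAt_const _ _ _,
        add_nonneg (by positivity) (mul_nonneg (by positivity) hw₀pos.le)⟩)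
      (le_max_left _ _) (by simp) 0 (by simp)
  have h1 : P.B 1 1 < P.A 1 1 * max (P.W₀ 1 1) (P.B 1 1 / P.A 1 1 + 1) := by
    have h2 : P.A 1 1 * (P.B 1 1 / P.A 1 1 + 1) ≤
        P.A 1 1 * max (P.W₀ 1 1) (P.B 1 1 / P.A 1 1 + 1) := mul_le_mul_of_nonneg_left hw₀ hA.le
    have h3 : P.A 1 1 * (P.B 1 1 / P.A 1 1 + 1) = P.B 1 1 + P.A 1 1 := by field_simp
    linarith
  nlinarith [mul_pos hw₀pos (sub_pos.2 h1)]

/-- The fast Riccati super-solutions: for `0 < ε ≤ 1/2`, `w(s) = 2ε/(ε − s)` has derivative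
`2ε/(ε − s)²  ≥ w² − w` at every `s < ε`. [folklore] -/
theorem hasDerivAt_fastBlowup {ε s : ℝ} (hs : s < ε) :
    HasDerivAt (fun r : ℝ => 2 * ε / (ε - r)) (2 * ε / (ε - s) ^ 2) s := by
  have hne : ε - s ≠ 0 := (sub_pos.2 hs).ne'
  have h := (hasDerivAt_const s (2 * ε)).div ((hasDerivAt_id s).const_sub ε) hne
  refine h.congr_deriv ?_
  simp

/-- **`¬ Step52_S2`** — §5.2 (S2) p.6 l.81–83 / §5.3 p.6 l.100–103 at the real-function grain: with
`A = B = 1` and any `c > 0`, the super-solution `w(s) = 2ε/(ε − s)` on `[0, ε)`,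
`ε = min(1/2, c/4)`, is continuous, has right derivative `≥ w² − w`, is unbounded as `s ↑ ε`, and has
`w(0) = 2 < c/ε`. [cite: Piromthan2025, §5.2 p.6 l.81–83] -/
theorem not_Step52_S2 : ¬ Step52_S2 := by
  intro h
  obtain ⟨c, hc, hS⟩ := h 1 1 one_pos one_pos
  set ε : ℝ := min (1 / 2) (c / 4) with hε
  have hε0 : 0 < ε := lt_min (by norm_num) (by linarith)
  have hε1 : ε ≤ 1 / 2 := min_le_left _ _
  have hε2 : ε ≤ c / 4 := min_le_right _ _
  have hcont : ContinuousOn (fun s : ℝ => 2 * ε / (ε - s)) (Ico 0 ε) :=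
    continuousOn_const.div (continuousOn_const.sub continuousOn_id)
      fun s hs => (sub_pos.2 hs.2).ne'
  have hder : ∀ t ∈ Ico 0 ε, HasDerivWithinAt (fun s : ℝ => 2 * ε / (ε - s)) (2 * ε / (ε - t) ^ 2)
      (Ici t) t ∧ 1 * (2 * ε / (ε - t)) ^ 2 - 1 * (2 * ε / (ε - t)) ≤ 2 * ε / (ε - t) ^ 2 := by
    intro t ht
    have hr : 0 < ε - t := sub_pos.2 ht.2
    refine ⟨(hasDerivAt_fastBlowup ht.2).hasDerivWithinAt, ?_⟩
    have hy : 0 ≤ 2 * ε / (ε - t) := by positivity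
    have hsq : (2 * ε / (ε - t)) ^ 2 ≤ 2 * ε / (ε - t) ^ 2 := by
      rw [div_pow]
      exact div_le_div_of_nonneg_right (by nlinarith) (by positivity)
    linarith
  have hunb : ∀ M : ℝ, ∃ s ∈ Ico 0 ε, M < 2 * ε / (ε - s) := by
    intro M
    have hM : 0 < |M| + 2 := by positivity
    refine ⟨ε * (1 - 1 / (|M| + 2)), ⟨?_, ?_⟩, ?_⟩
    · have : 1 / (|M| + 2) ≤ 1 := by
        rw [div_le_one hM]; linarith [abs_nonneg M]
      exact mul_nonneg hε0.le (by linarith)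
    · have : 0 < 1 / (|M| + 2) := by positivity
      nlinarith
    · have h1 : ε - ε * (1 - 1 / (|M| + 2)) = ε / (|M| + 2) := by
        field_simp
        ring
      have h2 : 2 * ε / (ε / (|M| + 2)) = 2 * (|M| + 2) := by
        field_simp
      rw [h1, h2]
      linarith [le_abs_self M, abs_nonneg M]
  have key := hS ε _ _ hcont hder hunb 0 (by simp [hε0])
  have h2 : 2 * ε / (ε - 0) = 2 := by rw [sub_zero]; field_simp
  rw [h2, sub_zero, div_le_iff₀ hε0] at key
  linarith

/-- **The abstract's weak-continuation face is false for every datum of the printed class**: a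
`C_c^∞` divergence-free `u₀` is in `L²` and weakly divergence free, so the tree's PROVED Leray theorem
`leray_existence_R3_holds` issues a global Leray–Hopf weak solution of the unforced system from it.
[cite: Piromthan2025, abstract p.1 l.10–11; §5.2 p.6 l.92–94] -/
theorem not_NoGlobalLerayHopf {ν : ℝ} (hν : 0 < ν) {u₀ : E3 → E3} (h : Piromthan2025.IsDatum u₀) :
    ¬ NoGlobalLerayHopf ν u₀ := fun hno =>
  hno (leray_existence_R3_holds ν hν u₀ (h.1.continuous.memLp_of_hasCompactSupport h.2.2)
    (VectorCalculus.IsDivFree.isWeaklyDivFree_holds h.2.1 (h.1.of_le (mod_cast le_top))))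

end Summit.NavierStokesRegularity.NavierStokesRegularity.Theorems.Piromthan2025

end
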